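import Summits.PneNP.PneNP.Theses.Descriptive

/-!
# Route Descriptive — `Assembly` (stmt-PneNP-14670)

`DescriptiveThesis → DescriptiveCfiNotCpt → NoCanonFP → NoPOptimalTaut → PneNP`: only the last rung
is load-bearing — the route's deciding theorem `Descriptive.closes : NoPOptimalTaut → PneNP`
(proved in the route file). This file imports only the route file.
-/

set_option linter.dupNamespace false -- `Summit.PneNP.PneNP.…`: summit = sub-problem name (D-0017 single-conjunct layout)

namespace Summit.PneNP.PneNP.Theorems

/-- **Assembly item of route Descriptive (stmt-PneNP-14670)**:
`DescriptiveThesis → DescriptiveCfiNotCpt → NoCanonFP → NoPOptimalTaut → PneNP`, by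
`Descriptive.closes` applied to the last hypothesis. [Krajíček–Pudlák 1989, §1; Chen–Flum 2010, §1] -/
theorem descriptive_assembly_proof :
    Summit.PneNP.PneNP.Theses.Descriptive.Assembly := by
  unfold Summit.PneNP.PneNP.Theses.Descriptive.Assembly
  exact fun _ _ _ hT => Summit.PneNP.PneNP.Theses.Descriptive.closes hT

end Summit.PneNP.PneNP.Theorems
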